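import Summits.BirchSwinnertonDyer.BirchSwinnertonDyer.Theorems.RamifiedSevenEllipticUnitsLemmaXiRamifiedValues
import Literature.NumberTheory.LFunctions.PrimesInRayClasses
import Literature.NumberTheory.QuadraticFields.ConjugateIdealClass
import HarnessLib

set_option linter.dupNamespace false
set_option autoImplicit false

/-!
# Lemma Ξ, kernel side (VI): infinitely many principal primes `w = (x)` with
# `‖τ(x/σx) − 1‖² = p⁻¹` EXACTLY — the place supplying the equality in clause (P5)

Helper file for the K7r Value crux `EllipticUnitValueSevenOfGZK` (stmt-BirchSwinnertonDyer-19945), line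
`rubin-formula-zp` v4/v4.1, stub `stub_rubinPackageSevenZp`, clause (P5)
`‖avatarValueAt R.r γ − 1‖² = p⁻¹`. By files (I)–(V) this clause follows from the `p`-adic sizes of
the values `φ_ac(ϖ_w) = τ(α_w/σα_w)` (`(α_w) = w`, Deuring): all are `≤ p^{−1/2}` from `1`, and ONE
place `w` off any prescribed finite set (the bad places of the member) must achieve
`‖τ(α_w/σα_w) − 1‖² = p⁻¹`. The cell worried this needs a density theorem (STATUS k7r-c2 g7
05:25Z/06:05Z, referee g43 05:52Z); the tree HAS it: Landau 1918 / Hecke 1917 "every narrow ray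
class contains infinitely many primes of degree one" is the PROVED theorem
`Literature.NumberTheory.LFunctions.exists_rayClassRel_prime_absNorm_not_mem`. This file applies it:

* §1 `norm_sq_smul_sub_eq_of_rayClass` — PERTURBATION: if `c x = b α₀` with `b ≡ c (mod p𝓞_K)`,
  `c ∉ 𝔭`, `α₀ ∉ 𝔭`, then `‖τ(σx − x)‖ = ‖τ(σα₀ − α₀)‖` and `x ∉ 𝔭` (the identity
  `σc·c·(σx − x) = σc·b·(σα₀ − α₀) + (c·σ(b−c) − σc·(b−c))·σα₀`, the last term of norm `≤ p⁻¹`);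
  `norm_embedding_div_smul_sub_one_sq_eq_of_norm` — file (III)'s equality case in norm form;
* §2 `exists_span_singleton_norm_sq_eq` — for `K` quadratic, `p ∣ d_K`, `𝔭 ∋ p`, ANY `τ : K → ℚ̄_p`,
  ANY finite set `S` and any `α₀ ∉ 𝔭` with `‖τ(σα₀ − α₀)‖² = p⁻¹`: there is a place `w ∉ S`, `w ∤ p`,
  `w = (x)` principal with `x ∉ 𝔭` and `‖τ(x/σx) − 1‖² = p⁻¹` (Landau in the narrow ray class of
  `(α₀)` modulo `p𝓞_K`);
* §3 the witness `α₀ = 1 + θ`, `θ² = −p` (`σθ = −θ` PROVED from Galois theory for `[K:ℚ] = 2`):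
  `exists_norm_sq_smul_sub_eq_of_sq_eq_neg` — so for `d_K = −p` (𝒞₇: `K = ℚ(√−7)`, `p = 7`) the
  hypothesis of §2 is met, and `exists_goodPlace_of_sq_eq_neg` packages §2+§3.

References: E. Landau, Math. Z. 2 (1918) §1; Neukirch, *Algebraic Number Theory*, VI (1.7)–(1.9), VII
(13.2); Silverman, *Advanced Topics*, II Cor. 10.4.1.
-/

noncomputable section

open scoped Classical NNReal Topology Pointwise
open NumberField IsDedekindDomain Field
  Literature.NumberTheory.GaloisRepresentations
  Literature.NumberTheory.LFunctions

namespace Summit.BirchSwinnertonDyer.BirchSwinnertonDyer.Theorems.RamifiedSevenEllipticUnits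

namespace LemmaXi

variable {K : Type} [Field K] [NumberField K] {p : ℕ} [hp : Fact p.Prime]

/-! ## §1 Perturbation inside a narrow ray class modulo `p𝓞_K` -/

/-- `σ` preserves non-membership in the ramified `𝔭` (`σx − x ∈ 𝔭`). [cite: NeukirchANT1999, Ch. I §9 Prop. (9.6)] -/
theorem smul_not_mem_of_not_mem (h2 : Module.finrank ℚ K = 2) (hdvd : (p : ℤ) ∣ NumberField.discr K)
    (𝔭 : HeightOneSpectrum (𝓞 K)) (hp𝔭 : ((p : ℕ) : 𝓞 K) ∈ 𝔭.asIdeal) (σ : K ≃ₐ[ℚ] K) {x : 𝓞 K}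
    (hx : x ∉ 𝔭.asIdeal) : σ • x ∉ 𝔭.asIdeal := fun h ↦
  hx (by simpa using Ideal.sub_mem _ h (smul_sub_mem_of_dvd_discr h2 hdvd 𝔭 hp𝔭 σ x))

/-- **File (III)'s equality case in norm form**: `α ∉ 𝔭`, `‖τ(σα − α)‖² = p⁻¹ ⇒ ‖τ(α/σα) − 1‖² = p⁻¹`
in `ℂ_p`. [cite: NeukirchANT1999, Ch. I §9 Prop. (9.6)] -/
theorem norm_embedding_div_smul_sub_one_sq_eq_of_norm (h2 : Module.finrank ℚ K = 2)
    (hdvd : (p : ℤ) ∣ NumberField.discr K) (𝔭 : HeightOneSpectrum (𝓞 K))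
    (hp𝔭 : ((p : ℕ) : 𝓞 K) ∈ 𝔭.asIdeal) (σ : K ≃ₐ[ℚ] K) (τ : K →+* PadicAlgCl p) {α : 𝓞 K}
    (hα : α ∉ 𝔭.asIdeal)
    (hδ : ‖(τ.comp (algebraMap (𝓞 K) K)) (σ • α - α)‖ ^ 2 = ((p : ℝ))⁻¹) :
    ‖((τ ((α : K) / σ (α : K)) : PadicAlgCl p) : ℂ_[p]) - 1‖ ^ 2 = ((p : ℝ))⁻¹ := by
  let τ' : 𝓞 K →+* PadicAlgCl p := τ.comp (algebraMap (𝓞 K) K)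
  have h1 : ‖τ' (σ • α)‖ = 1 :=
    norm_embedding_eq_one_of_not_mem h2 hdvd 𝔭 hp𝔭 τ (smul_not_mem_of_not_mem h2 hdvd 𝔭 hp𝔭 σ hα)
  have hcoe : τ' (σ • α) = τ (σ (α : K)) := rfl
  have hne : τ (σ (α : K)) ≠ 0 := by
    intro h0; rw [hcoe, h0, norm_zero] at h1; exact zero_ne_one h1
  have hval : τ ((α : K) / σ (α : K)) - 1 = -(τ' (σ • α - α) / τ (σ (α : K))) := by
    rw [map_div₀, map_sub, hcoe]
    change τ (α : K) / τ (σ (α : K)) - 1 = -((τ (σ (α : K)) - τ (α : K)) / τ (σ (α : K)))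
    field_simp
    ring
  rw [PadicComplex.coe_eq, ← map_one (algebraMap (PadicAlgCl p) ℂ_[p]), ← map_sub,
    ← PadicComplex.coe_eq, PadicComplex.norm_extends, hval, norm_neg, norm_div, ← hcoe, h1, div_one]
  exact hδ

/-- **Perturbation within a narrow ray class modulo `p𝓞_K`.** `K` quadratic, `p ∣ d_K`, `𝔭 ∋ p`,
`τ : K → ℚ̄_p` any ring map, `σ ∈ Aut(K/ℚ)`; if `c·x = b·α₀` in `𝓞_K` with `c, α₀ ∉ 𝔭` and
`b − c ∈ p𝓞_K`, then `x ∉ 𝔭` and `‖τ(σx − x)‖ = ‖τ(σα₀ − α₀)‖` PROVIDED `‖τ(σα₀ − α₀)‖² = p⁻¹`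
(the correction term has norm `≤ p⁻¹ < p^{−1/2}`). [cite: NeukirchANT1999, Ch. VI §1 Def. (1.7)] -/
theorem norm_sq_smul_sub_eq_of_rayClass (h2 : Module.finrank ℚ K = 2)
    (hdvd : (p : ℤ) ∣ NumberField.discr K) (𝔭 : HeightOneSpectrum (𝓞 K))
    (hp𝔭 : ((p : ℕ) : 𝓞 K) ∈ 𝔭.asIdeal) (σ : K ≃ₐ[ℚ] K) (τ : K →+* PadicAlgCl p)
    {α₀ x b c : 𝓞 K} (hα₀ : α₀ ∉ 𝔭.asIdeal) (hc : c ∉ 𝔭.asIdeal)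
    (hbc : b - c ∈ Ideal.span {((p : ℕ) : 𝓞 K)}) (hcx : c * x = b * α₀)
    (hδ₀ : ‖(τ.comp (algebraMap (𝓞 K) K)) (σ • α₀ - α₀)‖ ^ 2 = ((p : ℝ))⁻¹) :
    x ∉ 𝔭.asIdeal ∧ ‖(τ.comp (algebraMap (𝓞 K) K)) (σ • x - x)‖ ^ 2 = ((p : ℝ))⁻¹ := by
  let τ' : 𝓞 K →+* PadicAlgCl p := τ.comp (algebraMap (𝓞 K) K)
  have hple : Ideal.span {((p : ℕ) : 𝓞 K)} ≤ 𝔭.asIdeal :=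
    (Ideal.span_singleton_le_iff_mem _).mpr hp𝔭
  haveI := 𝔭.isPrime
  -- `b ∉ 𝔭`, `x ∉ 𝔭`
  have hb : b ∉ 𝔭.asIdeal := fun h ↦ hc (by simpa using Ideal.sub_mem _ h (hple hbc))
  have hx : x ∉ 𝔭.asIdeal := by
    intro h
    have : b * α₀ ∈ 𝔭.asIdeal := hcx ▸ Ideal.mul_mem_left _ c h
    rcases 𝔭.isPrime.mem_or_mem this with h' | h'
    · exact hb h'
    · exact hα₀ h'
  refine ⟨hx, ?_⟩
  -- the identity `σc·c·(σx − x) = σc·b·(σα₀ − α₀) + (c·(σb − σc) − σc·(b − c))·σα₀`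
  have hσ : σ • c * σ • x = σ • b * σ • α₀ := by rw [← smul_mul', hcx, smul_mul']
  have hid : σ • c * c * (σ • x - x) =
      σ • c * b * (σ • α₀ - α₀) + (c * (σ • b - σ • c) - σ • c * (b - c)) * σ • α₀ := by
    linear_combination c * hσ - (σ • c) * hcx
  -- norms of the pieces
  have hunit : ∀ {y : 𝓞 K}, y ∉ 𝔭.asIdeal → ‖τ' y‖ = 1 := fun hy ↦
    norm_embedding_eq_one_of_not_mem h2 hdvd 𝔭 hp𝔭 τ hy
  have hσc : ‖τ' (σ • c)‖ = 1 := hunit (smul_not_mem_of_not_mem h2 hdvd 𝔭 hp𝔭 σ hc)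
  have hcn : ‖τ' c‖ = 1 := hunit hc
  have hbn : ‖τ' b‖ = 1 := hunit hb
  have hσα₀ : ‖τ' (σ • α₀)‖ = 1 := hunit (smul_not_mem_of_not_mem h2 hdvd 𝔭 hp𝔭 σ hα₀)
  have hp0 : (0 : ℝ) < ((p : ℝ))⁻¹ := inv_pos.mpr (by exact_mod_cast hp.out.pos)
  have hp1 : ((p : ℝ))⁻¹ < 1 := inv_lt_one_of_one_lt₀ (by exact_mod_cast hp.out.one_lt)
  -- `‖τ'(b − c)‖ ≤ p⁻¹` and the same for `σ(b − c)`
  have hsmall : ∀ {y : 𝓞 K}, y ∈ Ideal.span {((p : ℕ) : 𝓞 K)} → ‖τ' y‖ ≤ ((p : ℝ))⁻¹ := by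
    intro y hy
    obtain ⟨t, ht⟩ := Ideal.mem_span_singleton'.mp hy
    rw [← ht, map_mul, norm_mul, norm_embedding_natCast]
    calc ‖τ' t‖ * ((p : ℝ))⁻¹ ≤ 1 * ((p : ℝ))⁻¹ :=
          mul_le_mul_of_nonneg_right (norm_embedding_coe_le_one τ t) hp0.le
      _ = ((p : ℝ))⁻¹ := one_mul _
  have hσp : σ • ((p : ℕ) : 𝓞 K) = ((p : ℕ) : 𝓞 K) :=
    map_natCast (MulSemiringAction.toRingHom (K ≃ₐ[ℚ] K) (𝓞 K) σ) p
  have hbc' : σ • b - σ • c ∈ Ideal.span {((p : ℕ) : 𝓞 K)} := by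
    obtain ⟨t, ht⟩ := Ideal.mem_span_singleton'.mp hbc
    rw [← smul_sub, ← ht, smul_mul', hσp]
    exact Ideal.mul_mem_left _ _ (Ideal.mem_span_singleton_self _)
  -- main term `T₁` and error term `T₂`
  set T₁ : PadicAlgCl p := τ' (σ • c * b * (σ • α₀ - α₀)) with hT₁def
  set T₂ : PadicAlgCl p := τ' ((c * (σ • b - σ • c) - σ • c * (b - c)) * σ • α₀) with hT₂def
  have hT₁ : ‖T₁‖ ^ 2 = ((p : ℝ))⁻¹ := by
    rw [hT₁def, map_mul, map_mul, norm_mul, norm_mul, hσc, hbn, one_mul, one_mul]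
    exact hδ₀
  have hT₂ : ‖T₂‖ ≤ ((p : ℝ))⁻¹ := by
    rw [hT₂def, map_mul, norm_mul, hσα₀, mul_one, map_sub, sub_eq_add_neg]
    refine (IsUltrametricDist.norm_add_le_max _ _).trans (max_le ?_ ?_)
    · rw [map_mul, norm_mul, hcn, one_mul]; exact hsmall hbc'
    · rw [norm_neg, map_mul, norm_mul, hσc, one_mul]; exact hsmall hbc
  have hlt : ‖T₂‖ < ‖T₁‖ := by
    by_contra h
    push Not at h
    have h' : ‖T₁‖ ≤ ((p : ℝ))⁻¹ := h.trans hT₂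
    have : ‖T₁‖ ^ 2 ≤ ((p : ℝ))⁻¹ * ((p : ℝ))⁻¹ := by
      rw [pow_two]; exact mul_le_mul h' h' (norm_nonneg _) hp0.le
    nlinarith [mul_lt_mul_of_pos_left hp1 hp0]
  have hsum : ‖T₁ + T₂‖ = ‖T₁‖ := by
    rw [IsUltrametricDist.norm_add_eq_max_of_norm_ne_norm hlt.ne', max_eq_left hlt.le]
  -- the left-hand side `σc·c·(σx − x)` has norm `‖τ'(σx − x)‖`
  have hL : ‖τ' (σ • c * c * (σ • x - x))‖ = ‖τ' (σ • x - x)‖ := by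
    rw [map_mul, map_mul, norm_mul, norm_mul, hσc, hcn, one_mul, one_mul]
  rw [← hL, hid, map_add, ← hT₁def, ← hT₂def, hsum, hT₁]

/-! ## §2 Landau: a principal prime in the class of `(α₀)` modulo `p𝓞_K`, off any finite set -/

/-- **A good split-type place with the exact valuation.** `K` quadratic, `p ∣ d_K`, `𝔭 ∋ p`, `τ : K → ℚ̄_p`
any ring map, `σ ∈ Aut(K/ℚ)`, `S` any finite set of places, `α₀ ∈ 𝓞_K ∖ 𝔭` with
`‖τ(σα₀ − α₀)‖² = p⁻¹`: there is a place `w ∉ S` with `p ∉ w`, `w = (x)` principal, `x ∉ 𝔭` and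
`‖τ(x/σx) − 1‖² = p⁻¹` — Landau's theorem (tree: `exists_rayClassRel_prime_absNorm_not_mem`) in the
narrow ray class of `(α₀)` modulo `p𝓞_K`, then §1. [cite: Landau1918Idealklassen, §1 Satz]
[cite: NeukirchANT1999, Ch. VI §1 Def. (1.7)] -/
theorem exists_span_singleton_norm_sq_eq (h2 : Module.finrank ℚ K = 2)
    (hdvd : (p : ℤ) ∣ NumberField.discr K) (𝔭 : HeightOneSpectrum (𝓞 K))
    (hp𝔭 : ((p : ℕ) : 𝓞 K) ∈ 𝔭.asIdeal) (σ : K ≃ₐ[ℚ] K) (τ : K →+* PadicAlgCl p)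
    (S : Set (HeightOneSpectrum (𝓞 K))) (hS : S.Finite) {α₀ : 𝓞 K} (hα₀ : α₀ ∉ 𝔭.asIdeal)
    (hδ₀ : ‖(τ.comp (algebraMap (𝓞 K) K)) (σ • α₀ - α₀)‖ ^ 2 = ((p : ℝ))⁻¹) :
    ∃ w : HeightOneSpectrum (𝓞 K), w ∉ S ∧ ((p : ℕ) : 𝓞 K) ∉ w.asIdeal ∧ ∃ x : 𝓞 K,
      w.asIdeal = Ideal.span {x} ∧ x ∉ 𝔭.asIdeal ∧
      ‖((τ ((x : K) / σ (x : K)) : PadicAlgCl p) : ℂ_[p]) - 1‖ ^ 2 = ((p : ℝ))⁻¹ := by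
  set 𝔪 : Ideal (𝓞 K) := Ideal.span {((p : ℕ) : 𝓞 K)} with h𝔪def
  have hp0' : ((p : ℕ) : 𝓞 K) ≠ 0 := by exact_mod_cast hp.out.ne_zero
  have h𝔪 : 𝔪 ≠ ⊥ := by rw [h𝔪def, Ne, Ideal.span_singleton_eq_bot]; exact hp0'
  haveI := 𝔭.isPrime
  -- `(α₀)` is nonzero and prime to `𝔪` (the only prime above `p` is `𝔭 ∌ α₀`)
  have hα₀0 : α₀ ≠ 0 := fun h ↦ hα₀ (h ▸ 𝔭.asIdeal.zero_mem)
  have hcop : ∀ {y : 𝓞 K}, y ∉ 𝔭.asIdeal → IsCoprime (Ideal.span {y}) 𝔪 := by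
    intro y hy
    rw [Ideal.isCoprime_iff_sup_eq]
    by_contra hne
    obtain ⟨M, hM, hle⟩ := Ideal.exists_le_maximal _ hne
    haveI := hM.isPrime
    have hpM : ((p : ℕ) : 𝓞 K) ∈ M := hle (Ideal.mem_sup_right (Ideal.mem_span_singleton_self _))
    have hM' : M = 𝔭.asIdeal := eq_asIdeal_of_dvd_discr h2 hdvd 𝔭 hp𝔭 hpM
    exact hy (hM' ▸ hle (Ideal.mem_sup_left (Ideal.mem_span_singleton_self _)))
  let 𝔟 : CoprimeIdeal 𝔪 := ⟨Ideal.span {α₀}, by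
    rw [Ne, Ideal.span_singleton_eq_bot]; exact hα₀0, hcop hα₀⟩
  obtain ⟨w, hwS, hw𝔪, hrel, -⟩ := exists_rayClassRel_prime_absNorm_not_mem h𝔪 𝔟 S hS
  have hpw : ((p : ℕ) : 𝓞 K) ∉ w.asIdeal := fun h ↦
    hw𝔪 ((Ideal.span_singleton_le_iff_mem _).mpr h)
  obtain ⟨b, c, hb0, hc0, hccop, hbc, -, heq⟩ := hrel
  -- `c ∉ 𝔭`
  have hc : c ∉ 𝔭.asIdeal := by
    intro hc𝔭
    have htop := Ideal.isCoprime_iff_sup_eq.mp hccop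
    have hle : Ideal.span {c} ⊔ 𝔪 ≤ 𝔭.asIdeal :=
      sup_le ((Ideal.span_singleton_le_iff_mem _).mpr hc𝔭) ((Ideal.span_singleton_le_iff_mem _).mpr hp𝔭)
    rw [htop] at hle
    exact 𝔭.isPrime.ne_top (top_le_iff.mp hle)
  -- a generator `x` of `w` with `c x = b α₀`
  have hmem : b * α₀ ∈ Ideal.span {c} * w.asIdeal := by
    rw [heq]; exact Ideal.mul_mem_mul (Ideal.mem_span_singleton_self b) (Ideal.mem_span_singleton_self α₀)
  obtain ⟨x, hxw, hcx⟩ := Ideal.mem_span_singleton_mul.mp hmem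
  have hwx : w.asIdeal = Ideal.span {x} := by
    have hc0' : Ideal.span {c} ≠ 0 := by
      rw [Ideal.zero_eq_bot, Ne, Ideal.span_singleton_eq_bot]; exact hc0
    refine mul_left_cancel₀ hc0' ?_
    rw [heq, Ideal.span_singleton_mul_span_singleton, Ideal.span_singleton_mul_span_singleton, hcx]
  obtain ⟨hx, hδ⟩ := norm_sq_smul_sub_eq_of_rayClass h2 hdvd 𝔭 hp𝔭 σ τ hα₀ hc hbc hcx hδ₀
  exact ⟨w, hwS, hpw, x, hwx, hx,
    norm_embedding_div_smul_sub_one_sq_eq_of_norm h2 hdvd 𝔭 hp𝔭 σ τ hx hδ⟩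

/-! ## §3 The witness `α₀ = 1 + θ`, `θ² = −p` -/

/-- In a quadratic field, a square root `θ` of a negative integer is moved by every non-trivial
automorphism: `σθ = −θ` (`σθ = ±θ`, and `σθ = θ` would put `θ` in the fixed field `ℚ`, where `−p`
is not a square). [folklore] -/
theorem smul_eq_neg_of_sq_eq_neg (h2 : Module.finrank ℚ K = 2) (σ : K ≃ₐ[ℚ] K) (hσ : σ ≠ 1)
    {θ : 𝓞 K} (hθ : θ ^ 2 = -((p : ℕ) : 𝓞 K)) : σ • θ = -θ := by
  haveI : Algebra.IsQuadraticExtension ℚ K := ⟨h2⟩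
  have hG : Nat.card (K ≃ₐ[ℚ] K) = 2 := by rw [IsGalois.card_aut_eq_finrank, h2]
  -- `σθ = ±θ`
  have hσp : σ • ((p : ℕ) : 𝓞 K) = ((p : ℕ) : 𝓞 K) :=
    map_natCast (MulSemiringAction.toRingHom (K ≃ₐ[ℚ] K) (𝓞 K) σ) p
  have hsq : (σ • θ) ^ 2 = θ ^ 2 := by
    rw [← smul_pow', hθ, smul_neg, hσp]
  have hpm : σ • θ = θ ∨ σ • θ = -θ := by
    have : (σ • θ - θ) * (σ • θ + θ) = 0 := by linear_combination hsq
    rcases mul_eq_zero.mp this with h | h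
    · exact Or.inl (sub_eq_zero.mp h)
    · exact Or.inr (eq_neg_of_add_eq_zero_left h)
  rcases hpm with h | h
  · -- then `θ` is fixed by all of `Gal(K/ℚ) = {1, σ}`, so rational: impossible
    exfalso
    have hfix : ∀ g : K ≃ₐ[ℚ] K, g (θ : K) = (θ : K) := by
      intro g
      rcases Literature.NumberTheory.QuadraticFields.eq_one_or_eq_of_card_eq_two hG hσ g with rfl | rfl
      · rfl
      · exact congrArg (algebraMap (𝓞 K) K) h
    have hmem : (θ : K) ∈ IntermediateField.fixedField (⊤ : Subgroup (K ≃ₐ[ℚ] K)) :=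
      fun g ↦ hfix g
    rw [IsGalois.fixedField_top, IntermediateField.mem_bot] at hmem
    obtain ⟨q, hq⟩ := hmem
    have hθK : ((θ : K)) ^ 2 = -((p : ℕ) : K) := by
      have := congrArg (algebraMap (𝓞 K) K) hθ
      simpa using this
    rw [← hq, ← map_pow, ← map_natCast (algebraMap ℚ K), ← map_neg,
      (algebraMap ℚ K).injective.eq_iff] at hθK
    have : (0 : ℚ) < (p : ℕ) := by exact_mod_cast hp.out.pos
    nlinarith [sq_nonneg q]
  · exact h

/-- **The witness for `d_K = −p`**: if `θ ∈ 𝓞_K` with `θ² = −p` (`p` odd) and `σ ≠ 1`, then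
`α₀ := 1 + θ ∉ 𝔭` and `‖τ(σα₀ − α₀)‖² = p⁻¹` for every `τ : K → ℚ̄_p` (`σα₀ − α₀ = −2θ`,
`‖2‖ = 1`, `‖θ‖² = ‖p‖`). [cite: NeukirchANT1999, Ch. I §9 Prop. (9.6)] -/
theorem exists_norm_sq_smul_sub_eq_of_sq_eq_neg (h2 : Module.finrank ℚ K = 2)
    (𝔭 : HeightOneSpectrum (𝓞 K))
    (hp𝔭 : ((p : ℕ) : 𝓞 K) ∈ 𝔭.asIdeal) (hp2 : p ≠ 2) (σ : K ≃ₐ[ℚ] K) (hσ : σ ≠ 1)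
    (τ : K →+* PadicAlgCl p) {θ : 𝓞 K} (hθ : θ ^ 2 = -((p : ℕ) : 𝓞 K)) :
    (1 + θ) ∉ 𝔭.asIdeal ∧
      ‖(τ.comp (algebraMap (𝓞 K) K)) (σ • (1 + θ) - (1 + θ))‖ ^ 2 = ((p : ℝ))⁻¹ := by
  let τ' : 𝓞 K →+* PadicAlgCl p := τ.comp (algebraMap (𝓞 K) K)
  haveI := 𝔭.isPrime
  have hσθ : σ • θ = -θ := smul_eq_neg_of_sq_eq_neg h2 σ hσ hθ
  have hθ𝔭 : θ ∈ 𝔭.asIdeal := by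
    have : θ ^ 2 ∈ 𝔭.asIdeal := by rw [hθ]; exact 𝔭.asIdeal.neg_mem hp𝔭
    exact 𝔭.isPrime.mem_of_pow_mem 2 this
  refine ⟨fun h ↦ ?_, ?_⟩
  · -- `1 + θ ∈ 𝔭` and `θ ∈ 𝔭` give `1 ∈ 𝔭`
    exact 𝔭.isPrime.ne_top ((Ideal.eq_top_iff_one _).mpr (by simpa using Ideal.sub_mem _ h hθ𝔭))
  · have hδ : σ • (1 + θ) - (1 + θ) = -(2 * θ) := by rw [smul_add, smul_one, hσθ]; ring
    have h2n : ‖τ' 2‖ = 1 := by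
      rw [map_ofNat]
      have : ‖((2 : ℕ) : PadicAlgCl p)‖ = 1 := by
        rw [← map_natCast (algebraMap ℚ_[p] (PadicAlgCl p)) 2, PadicAlgCl.norm_extends,
          Padic.norm_natCast_eq_one_iff]
        exact (Nat.coprime_primes hp.out Nat.prime_two).mpr hp2
      exact_mod_cast this
    have hθn : ‖τ' θ‖ ^ 2 = ((p : ℝ))⁻¹ := by
      rw [← norm_pow, ← map_pow, hθ, map_neg, norm_neg, norm_embedding_natCast]
    rw [hδ, map_neg, norm_neg, map_mul, norm_mul, h2n, one_mul, hθn]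

/-- **(P5)'s place, assembled**: for `K` quadratic with `θ ∈ 𝓞_K`, `θ² = −p`, `p ∣ d_K` odd, `𝔭 ∋ p`,
`σ ≠ 1`, ANY `τ : K → ℚ̄_p` and ANY finite `S`: there is `w ∉ S`, `p ∉ w`, `w = (x)`, `x ∉ 𝔭`,
`‖τ(x/σx) − 1‖² = p⁻¹`. For 𝒞₇: `K = ℚ(√−7)`, `p = 7`, `S` = the bad places of the member; with
Deuring (Silverman II Cor. 10.4.1 (a)) `φ_ac(ϖ_w) = τ(±x/σ(±x))` this is the equality input `hone` of
`RubinPadicLFunctionData.norm_avatarValueAt_sub_one_sq_eq_of_φac`. [cite: Landau1918Idealklassen, §1 Satz]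
[cite: SilvermanATAEC1994, Ch. II Cor. 10.4.1 (a)] -/
theorem exists_goodPlace_of_sq_eq_neg (h2 : Module.finrank ℚ K = 2)
    (hdvd : (p : ℤ) ∣ NumberField.discr K) (𝔭 : HeightOneSpectrum (𝓞 K))
    (hp𝔭 : ((p : ℕ) : 𝓞 K) ∈ 𝔭.asIdeal) (hp2 : p ≠ 2) (σ : K ≃ₐ[ℚ] K) (hσ : σ ≠ 1)
    (τ : K →+* PadicAlgCl p) {θ : 𝓞 K} (hθ : θ ^ 2 = -((p : ℕ) : 𝓞 K))
    (S : Set (HeightOneSpectrum (𝓞 K))) (hS : S.Finite) :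
    ∃ w : HeightOneSpectrum (𝓞 K), w ∉ S ∧ ((p : ℕ) : 𝓞 K) ∉ w.asIdeal ∧ ∃ x : 𝓞 K,
      w.asIdeal = Ideal.span {x} ∧ x ∉ 𝔭.asIdeal ∧
      ‖((τ ((x : K) / σ (x : K)) : PadicAlgCl p) : ℂ_[p]) - 1‖ ^ 2 = ((p : ℝ))⁻¹ := by
  obtain ⟨hα₀, hδ₀⟩ := exists_norm_sq_smul_sub_eq_of_sq_eq_neg h2 𝔭 hp𝔭 hp2 σ hσ τ hθ
  exact exists_span_singleton_norm_sq_eq h2 hdvd 𝔭 hp𝔭 σ τ S hS hα₀ hδ₀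

end LemmaXi

end Summit.BirchSwinnertonDyer.BirchSwinnertonDyer.Theorems.RamifiedSevenEllipticUnits

end
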